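import Literature.Analysis.FluidPDE.NSCriticalClosureBesovProofs
import HarnessLib

/-!
# The critical Besov continuation criterion — the smoothing step for *bounded* Besov mild solutions

Sibling of `Literature/Analysis/FluidPDE/NSCriticalClosureBesov.lean`, whose assembly
`Literature.Analysis.FluidPDE.hasSmoothExtensionPast_of_eHomBesovNorm_bounded_of_gkp` derives the
named fact `Literature.Analysis.FluidPDE.hasSmoothExtensionPast_of_eHomBesovNorm_bounded`
(Gallagher–Koch–Planchon 2016, Thm. 1, contrapositive) from `gkp_besov_blowup`, three Tao 2013
facts, two Littlewood–Paley facts (both discharged in `NSCriticalClosureBesovProofs.lean`) and the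
smoothing fact `gkp_smooth_of_isBesovMildSolutionOn` (GKP (1.6): a Besov mild solution is, at
positive times, a.e. equal to a classical solution).

## Why a second smoothing fact

`gkp_smooth_of_isBesovMildSolutionOn` quantifies over *every* member `(u, U)` of the class
`IsBesovMildSolutionOn` of `CriticalRegularity.lean`. That class controls `u` near `t = 0` only
through Kato's weight, `‖u(τ)‖_∞ ≤ C t^{-1/2}`… more precisely `sup_{0<τ<t} √τ ‖u(τ)‖_∞ < ∞`, so
the a priori bound on the nonlinear integrand of the duality-form Duhamel identity
(`Fluid.IsMildNSSolutionFrom`: `τ ↦ ∫ ⟪u τ, (u τ · ∇) e^{ν(t-τ)Δ} φ⟫`) is `C² τ⁻¹ ‖∇φ‖_{L¹}`,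
which is not integrable at `τ = 0`. The identity is a Mathlib Bochner integral in `τ`, i.e. `0`
when the integrand is not integrable; a proof of the smoothing fact for the whole class would
have to control this junk regime, which no printed argument does (GKP's `NS(u₀)` lies in
`𝓛^{1:∞}_{p,q}`, where the integrand is integrable). The assembly, however, only ever applies
the smoothing fact to Besov mild solutions which are **bounded down to `t = 0`**: the extension
`(v, V)` of the classical solution `u` produced by non-maximality agrees a.e. with `u` on `[0, T)`,
and `u` is bounded on closed slabs (Tao 2013, Cor. 11.1 + Cor. 4.3 + Thm. 5.4 (iv) with the
Sobolev imbedding, already an input of the assembly), while on `[T - ε, T₁]`, `T₁ < T'`, Kato's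
weight bounds `v`. For bounded fields every integral in the Duhamel identity converges
absolutely, and the smoothing statement is the printed regularity theory of **bounded weak
solutions** of Koch–Nadirashvili–Seregin–Šverák 2009, §§3–4.

This file therefore

* records the named fact `Literature.Analysis.FluidPDE.knss_classical_of_bounded_isBesovMildSolutionOn`
  (KNSS 2009, §4 with Lemma 3.1, Rem. 3.1, Prop. 4.1; GKP 2016, (1.6)): a Besov mild solution on
  `[0, T)` whose slices are uniformly essentially bounded on every `(0, T₁)`, `T₁ < T`, agrees at
  every `t ∈ (0, T)`, a.e., with a classical solution on `(0, T)` — a statement *implied by*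
  `gkp_smooth_of_isBesovMildSolutionOn` (`knss_classical_of_bounded_isBesovMildSolutionOn_of_gkp_smooth`),
  so nothing is lost;
* proves that the Besov mild extension of a classical solution bounded on closed slabs has
  uniformly bounded slices (`IsBesovMildSolutionOn.exists_eLpNorm_top_le_of_extension`), the
  extension step `hasSmoothExtensionPast_of_isBesovMildSolutionOn_extension_of_bounded`, and the
  re-routed assembly `hasSmoothExtensionPast_of_eHomBesovNorm_bounded_of_gkp_knss` (from
  `gkp_besov_blowup`, the three Tao facts and the KNSS fact — the two Littlewood–Paley facts being
  fed by their discharges). A former record,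
  `hasSmoothExtensionPast_of_eHomBesovNorm_bounded_of_criticalElements_knss` — the same assembly
  with GKP Thm. 1 opened up into GKP §2.1: from (1.9), Props. 2.1, 2.2 and 2.3 via
  `gkp_besov_blowup_of_criticalElements` — was dropped when the tree-class rendering
  `gkp_rigidity` of Prop. 2.3 was merged back into the proof obligation of Thm. 1 on review
  (2026-08-15, D-0026: mis-stated over the tree's class, Step 3 of the printed proof by
  contradiction, and a corollary of `gkp_besov_blowup` itself, `gkp_rigidity_of_gkp_besov_blowup`):
  Prop. 2.3 is no longer a named fact of the tree, so that record was no longer one on named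
  facts; it is a one-line composition of `hasSmoothExtensionPast_of_eHomBesovNorm_bounded_of_gkp_knss`
  with `gkp_besov_blowup_of_criticalElements`, which keeps the statement of Prop. 2.3 as an
  explicit hypothesis.

## The printed theory behind `knss_classical_of_bounded_isBesovMildSolutionOn`

KNSS 2009 (arXiv:0709.3599), §3: for `f ∈ L^∞_{x,t}` the *mild* solution of the linear Stokes
problem `u_t + ∇p - Δu = ∂_k f_k`, `div u = 0`, `u(0) = u₀` is given by the Oseen kernel
`K_{ijk} = ∂_k K_{ij}`, `|K_{ijk}(x,t)| ≤ C (|x|² + t)^{-(n+1)/2}`; a *weak* solution is a bounded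
measurable `u`, `div u = 0`, with `∫∫ u (φ_t + Δφ) = ∫∫ f_k ∂_k φ` for all smooth compactly
supported divergence-free `φ` on `ℝⁿ × (0, T)`. **Lemma 3.1**: every bounded weak solution is
`u = v + w + b(t)` with `v` the mild solution from `u₀ = 0`, `w` a bounded caloric function and
`b ∈ L^∞(0, T; ℝⁿ)`; **Rem. 3.1**: `b'` is determined by `u`. §4 (bounded solutions of
Navier–Stokes, `f_k = -u_k u`): for a bounded weak solution `u` with `M = ‖u‖_{L^∞_{x,t}}`,
`‖∇ᵏ_x u‖_{L^∞(ℝⁿ × (δ,T))} ≤ C(k, δ, T, M)` and `‖∇ᵏ_x ∂_t (u - b)‖_{L^∞(ℝⁿ × (δ,T))} ≤ C` for all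
`k`, `δ > 0`; **Prop. 4.1**: mild solutions from `L^∞` data have `t^{k/2+l} ∇ᵏ_x ∂ˡ_t u` bounded.
For a Besov mild solution with bounded slices the duality identities of `Fluid.IsMildNSSolutionOn`
are absolutely convergent and make `u` a bounded weak solution on `ℝ³ × (0, T₁)` in this sense;
the realisation condition `Ṡ_j U t → 0` (`j → -∞`) of `Literature.Analysis.FunctionSpaces.MemHomBesov`
(BCD Def. 1.26), valid at **every** `t ∈ [0, T)`, forces `b` to be constant — `b(t₂) - b(t₁)` is
the large-scale mean of `(u - b)(t₁) - (u - b)(t₂) = -∫_{t₁}^{t₂} ∂_t (u - b)`, a sum of spatial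
derivatives of bounded (`Δ ∫ w`, `Δ ∫ v`) and `BMO` (`P ∂_k ∫ f_k`) functions, whose low-frequency
cut-offs tend to `0` in `𝓢'` — so that `u` itself is smooth on `ℝ³ × (0, T)` with bounded
derivatives on every `ℝ³ × (δ, T₁)` (Prop. 4.1 from the datum `u(δ)`), solves the projected
equation, and the smooth curl-free field `-(∂_t u + (u·∇)u - νΔu)` is a gradient `∇π` (Poincaré
lemma), i.e. `(u, π)` is classical on `(0, T)`; `U ∈ C([0,T); Ḃ) ⊂ C([0,T); 𝓢')` upgrades "a.e.
`t`" to "every `t`". This is the class-level content of GKP 2016, (1.6)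
(`NS(u₀) ∈ C^∞(ℝ³ × (0, T])`).

## What remains for `hasSmoothExtensionPast_of_eHomBesovNorm_bounded_holds` along this route

The discharge of `gkp_besov_blowup` (GKP Thm. 1: Props. 2.1–2.3, profile decompositions), of
the Tao 2013 facts `tao2011_hasBoundedSobolevNormsOn` (Cor. 11.1 + Cor. 4.3 + Thm. 5.4 (iv)),
`tao2011_isMildNSSolutionOn_of_memSobolevX` (Cor. 4.3), `tao2011_smooth_local_existence`
(Thm. 5.4), and of `knss_classical_of_bounded_isBesovMildSolutionOn` (KNSS 2009, §§3–4).

## References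

* G. Koch, N. Nadirashvili, G. Seregin, V. Šverák, *Liouville theorems for the Navier–Stokes
  equations and applications*, Acta Math. 203 (2009), 83–105 = arXiv:0709.3599: §3 (Oseen
  kernel, mild and weak solutions of the Stokes problem, Lemma 3.1, Rem. 3.1), §4 (bounded weak
  solutions of Navier–Stokes: the `L^∞` bounds for `∇ᵏ_x u` and `∇ᵏ_x ∂_t(u - b)`; Prop. 4.1).
* I. Gallagher, G. S. Koch, F. Planchon, Comm. Math. Phys. 343 (2016) 39–82 = arXiv:1407.4156:
  (1.2), (1.6) (p. 4), Thm. 1 (p. 5).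
* H. Bahouri, J.-Y. Chemin, R. Danchin, *Fourier Analysis and Nonlinear PDE* (2011), Def. 1.26
  (the realisation condition of homogeneous Besov spaces).
* T. Tao, Anal. PDE 6 (2013) 25–107 = arXiv:1108.1165: Cor. 11.1, Cor. 4.3, Thm. 5.4.
-/

noncomputable section

open MeasureTheory TemperedDistribution Set Function Filter
open _root_.Topology
open scoped SchwartzMap ENNReal NNReal

namespace Literature.Analysis.FluidPDE

/-- Local notation for physical space `ℝ³ = EuclideanSpace ℝ (Fin 3)`. -/
local notation "ℝ³" => EuclideanSpace ℝ (Fin 3)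

/-- Local notation for the complexified target `ℂ³ = EuclideanSpace ℂ (Fin 3)`. -/
local notation "ℂ³" => EuclideanSpace ℂ (Fin 3)

/-! ## The named fact -/

section Fact

/-- **Bounded Besov mild solutions are classical at positive times** (Koch–Nadirashvili–
Seregin–Šverák 2009, §4 — regularity of bounded weak solutions of Navier–Stokes on `ℝⁿ × (0,T)`:
`‖∇ᵏ_x u‖_{L^∞(ℝⁿ×(δ,T))} ≤ C(k,δ,T,M)`, `‖∇ᵏ_x ∂_t(u - b)‖_{L^∞(ℝⁿ×(δ,T))} ≤ C`, with the
decomposition `u = v + w + b(t)` of Lemma 3.1 / Rem. 3.1 and the smoothing Prop. 4.1 — combined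
with the realisation condition of `Ḃ^{s_p}_{p,q}` (BCD Def. 1.26), which forces the drift `b` to be
constant; the class-level form of Gallagher–Koch–Planchon 2016, (1.6),
`NS(u₀) ∈ C^∞(ℝ³ × (0,T])`; see the module docstring for the chain). Let `ν > 0`, `3 < p < ∞`,
`1 ≤ q < ∞`, and let `(u, U)` be a Besov mild solution on `[0, T)` in the class
`(-1 + 3/p, p, q)` of `CriticalRegularity.lean` whose slices are uniformly essentially bounded on
every `(0, T₁)`, `T₁ < T` (`u ∈ L^∞(ℝ³ × (0, T₁))`, the setting of KNSS Rem. 4.1; under this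
hypothesis every integral in the duality-form Duhamel identity converges absolutely). Then there
is a classical solution `(v, π)` of the unforced system on the open time interval `(0, T)` with
`u(t) = v(t)` a.e. for every `t ∈ (0, T)`. This is the special case of
`gkp_smooth_of_isBesovMildSolutionOn` actually consumed by the continuation criterion
(`knss_classical_of_bounded_isBesovMildSolutionOn_of_gkp_smooth`). [cite: KochNadirashviliSereginSverak2009, §4 with Lemma 3.1, Rem. 3.1, Prop. 4.1] -/
def knss_classical_of_bounded_isBesovMildSolutionOn : Prop :=
  ∀ ⦃ν T : ℝ⦄, 0 < ν → 0 < T → ∀ ⦃p q : ℝ≥0∞⦄ [Fact (1 ≤ p)], 3 < p → p < ∞ → 1 ≤ q → q < ∞ →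
    ∀ ⦃u : ℝ → ℝ³ → ℝ³⦄ ⦃U : ℝ → 𝓢'(ℝ³, ℂ³)⦄,
      IsBesovMildSolutionOn (-1 + 3 / p.toReal) p q T ν u U →
        (∀ T₁ ∈ Ioo 0 T, ∃ C : ℝ≥0∞, C < ∞ ∧ ∀ t ∈ Ioo 0 T₁, eLpNorm (u t) ∞ volume ≤ C) →
          ∃ (v : ℝ → ℝ³ → ℝ³) (π : ℝ → ℝ³ → ℝ),
            FluidPDE.IsClassicalNSSolutionOn (Ioo 0 T) ν 0 v π ∧ ∀ t ∈ Ioo 0 T, u t =ᵐ[volume] v t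

-- `linter.deprecated` is switched off for the next declaration only: its hypothesis `hS` is the
-- tree-class rendering `gkp_smooth_of_isBesovMildSolutionOn` of GKP (1.6) (`NSCriticalClosureBesov.lean`),
-- deprecated as mis-stated by the verdict clean-up of 2026-08-16 and kept verbatim for this record.
set_option linter.deprecated false in
/-- The bounded smoothing fact is a special case of GKP (1.6) in the form
`gkp_smooth_of_isBesovMildSolutionOn` (drop the boundedness hypothesis; that form is deprecated —
mis-stated over the tree's class, `NSCriticalClosureBesov.lean` §Verdict clean-up — and this
implication is kept as the record that nothing was lost in the re-routing). [cite: GKP2016, (1.6)] -/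
theorem knss_classical_of_bounded_isBesovMildSolutionOn_of_gkp_smooth
    (hS : gkp_smooth_of_isBesovMildSolutionOn) :
    knss_classical_of_bounded_isBesovMildSolutionOn :=
  fun _ν _T hν hT _p _q _ hp₃ hp hq₁ hq _u _U hB _ => hS hν hT hp₃ hp hq₁ hq hB

end Fact

/-! ## The extension of a bounded classical solution has bounded slices -/

section Bounded

variable {ν T T' : ℝ} {u : ℝ → ℝ³ → ℝ³}

/-- **Uniform slice bounds for the Besov mild extension.** Let `u` be bounded on every closed
slab `[0, T₁] × ℝ³`, `T₁ < T` (`0 < T`), and let `(v, V)` be a Besov mild solution on `[0, T')`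
with `v(t) = u(t)` a.e. for every `t ∈ [0, T)`. Then the slices of `v` are uniformly
essentially bounded on every `(0, T₁)`, `T₁ < T'`: for `t ≤ T/2`, `‖v(t)‖_∞ = ‖u(t)‖_∞ ≤ M`; for
`t > T/2`, Kato's weight (`MemKatoClassOn`: `sup_{0<τ<T₁} √τ ‖v(τ)‖_∞ = K < ∞`) gives
`‖v(t)‖_∞ ≤ K / √(T/2)`. [folklore] -/
theorem IsBesovMildSolutionOn.exists_eLpNorm_top_le_of_extension (hT : 0 < T)
    (hbdd : ∀ T₁ ∈ Ioo 0 T, ∃ M : ℝ, ∀ t ∈ Icc 0 T₁, ∀ x, ‖u t x‖ ≤ M)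
    {s : ℝ} {r q : ℝ≥0∞} [Fact (1 ≤ r)] {v : ℝ → ℝ³ → ℝ³} {V : ℝ → 𝓢'(ℝ³, ℂ³)}
    (hv : IsBesovMildSolutionOn s r q T' ν v V) (hvu : ∀ t ∈ Ico 0 T, v t =ᵐ[volume] u t) :
    ∀ T₁ ∈ Ioo 0 T', ∃ C : ℝ≥0∞, C < ∞ ∧ ∀ t ∈ Ioo 0 T₁, eLpNorm (v t) ∞ volume ≤ C := by
  intro T₁ hT₁
  have hT2 : T / 2 ∈ Ioo 0 T := ⟨half_pos hT, half_lt_self hT⟩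
  obtain ⟨M, hM⟩ := hbdd (T / 2) hT2
  -- Kato's weight on `(0, T₁)`
  set K : ℝ≥0∞ := ⨆ τ ∈ Ioo 0 T₁, ENNReal.ofReal (Real.sqrt τ) * eLpNorm (v τ) ∞ volume with hK
  have hKtop : K < ∞ := hv.memKatoClassOn.1 T₁ hT₁.2
  set a : ℝ≥0∞ := ENNReal.ofReal (Real.sqrt (T / 2)) with ha
  have ha0 : a ≠ 0 := by
    rw [ha]
    exact (ENNReal.ofReal_pos.2 (Real.sqrt_pos.2 hT2.1)).ne'
  refine ⟨ENNReal.ofReal M + K / a, ?_, fun t ht => ?_⟩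
  · exact ENNReal.add_lt_top.2 ⟨ENNReal.ofReal_lt_top,
      ENNReal.div_lt_top hKtop.ne ha0⟩
  rcases le_or_gt t (T / 2) with hle | hgt
  · -- `t ≤ T/2 < T`: `v t = u t` a.e. and `u` is bounded by `M` on `[0, T/2]`
    have htT : t ∈ Ico 0 T := ⟨ht.1.le, hle.trans_lt hT2.2⟩
    have h1 : eLpNorm (v t) ∞ volume = eLpNorm (u t) ∞ volume := eLpNorm_congr_ae (hvu t htT)
    have h2 : eLpNorm (u t) ∞ volume ≤ ENNReal.ofReal M := by
      rw [eLpNorm_exponent_top]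
      exact eLpNormEssSup_le_of_ae_bound (Eventually.of_forall (hM t ⟨ht.1.le, hle⟩))
    exact (h1.le.trans h2).trans le_self_add
  · -- `T/2 < t < T₁`: Kato's weight
    have hb : ENNReal.ofReal (Real.sqrt t) * eLpNorm (v t) ∞ volume ≤ K :=
      le_iSup₂ (f := fun τ (_ : τ ∈ Ioo (0 : ℝ) T₁) =>
        ENNReal.ofReal (Real.sqrt τ) * eLpNorm (v τ) ∞ volume) t ht
    have hbt0 : ENNReal.ofReal (Real.sqrt t) ≠ 0 :=
      (ENNReal.ofReal_pos.2 (Real.sqrt_pos.2 ht.1)).ne'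
    have h1 : eLpNorm (v t) ∞ volume ≤ K / ENNReal.ofReal (Real.sqrt t) := by
      rw [ENNReal.le_div_iff_mul_le (Or.inl hbt0) (Or.inl ENNReal.ofReal_ne_top), mul_comm]
      exact hb
    have h2 : K / ENNReal.ofReal (Real.sqrt t) ≤ K / a :=
      ENNReal.div_le_div_left (ENNReal.ofReal_le_ofReal (Real.sqrt_le_sqrt hgt.le)) K
    exact (h1.trans h2).trans le_add_self

end Bounded

/-! ## The extension step and the re-routed assemblies -/

section Assembly

/-- **From a Besov mild extension to a smooth extension, bounded form** (KNSS 2009, §4; GKP 2016,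
(1.6); Beale–Kato–Majda 1984, §1 for the continuation vocabulary). Given the fact
`knss_classical_of_bounded_isBesovMildSolutionOn`: if `(u, p)` is classical on `[0, T)` and
bounded on every closed slab `[0, T₁] × ℝ³`, `T₁ < T`, `0 < T < T'`, and a Besov mild solution
`(v, V)` on `[0, T')` (class `(-1 + 3/r, r, q)`, `3 < r < ∞`, `1 ≤ q < ∞`) agrees with `u` a.e.
at every time of `[0, T)`, then `u` extends smoothly past `T`: the slices of `v` are uniformly
bounded on every `(0, T₁)`, `T₁ < T'` (`IsBesovMildSolutionOn.exists_eLpNorm_top_le_of_extension`),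
so `v` agrees a.e. with a classical `(u', p')` on `(0, T')`; continuous slices that agree a.e. are
equal, so `u' = u` on `(0, T)`, and `IsClassicalNSSolutionOn.glue` glues `(u, p)` on `[0, T)` to
`(u', p')` on `(0, T')`. [cite: KochNadirashviliSereginSverak2009, §4] -/
theorem hasSmoothExtensionPast_of_isBesovMildSolutionOn_extension_of_bounded
    (hK : knss_classical_of_bounded_isBesovMildSolutionOn) {ν T T' : ℝ} (hν : 0 < ν) (hT : 0 < T)
    (hTT' : T < T') {u : ℝ → ℝ³ → ℝ³} {p : ℝ → ℝ³ → ℝ}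
    (hsol : FluidPDE.IsClassicalNSSolutionOn (Ico 0 T) ν 0 u p)
    (hbdd : ∀ T₁ ∈ Ioo 0 T, ∃ M : ℝ, ∀ t ∈ Icc 0 T₁, ∀ x, ‖u t x‖ ≤ M) {r q : ℝ≥0∞}
    [Fact (1 ≤ r)] (hr₃ : 3 < r) (hr : r < ∞) (hq₁ : 1 ≤ q) (hq : q < ∞) {v : ℝ → ℝ³ → ℝ³}
    {V : ℝ → 𝓢'(ℝ³, ℂ³)} (hv : IsBesovMildSolutionOn (-1 + 3 / r.toReal) r q T' ν v V)
    (hvu : ∀ t ∈ Ico 0 T, v t =ᵐ[volume] u t) : FluidPDE.HasSmoothExtensionPast ν 0 u T := by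
  obtain ⟨u', p', hcl, hae⟩ := hK hν (hT.trans hTT') hr₃ hr hq₁ hq hv
    (hv.exists_eLpNorm_top_le_of_extension hT hbdd hvu)
  have heq : ∀ t ∈ Ioo 0 T, u t = u' t := fun t ht => by
    have h1 : u t =ᵐ[volume] u' t :=
      (hvu t ⟨ht.1.le, ht.2⟩).symm.trans (hae t ⟨ht.1, ht.2.trans hTT'⟩)
    exact (Continuous.ae_eq_iff_eq volume (hsol.contDiff_velocity ⟨ht.1.le, ht.2⟩).continuous
      (hcl.contDiff_velocity ⟨ht.1, ht.2.trans hTT'⟩).continuous).1 h1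
  refine ⟨T', hTT', _, _, hsol.glue hcl le_rfl hT hTT'.le heq, fun t ht => ?_⟩
  simp only [if_pos ht.2]

/-- **Boundedness on closed slabs** of a classical unforced solution on `[0, T) × ℝ³` which is
Leray–Hopf from its rapidly decaying datum (Tao 2013, Cor. 11.1 + Cor. 4.3 + Thm. 5.4 (iv), named
fact `tao2011_hasBoundedSobolevNormsOn`, with the discharged Sobolev imbedding
`linfty_bound_of_hasBoundedSobolevNormsOn_holds`): `‖u(t, x)‖ ≤ M(T₁)` on `[0, T₁] × ℝ³` for every
`T₁ < T` (the energy on the closed slab is bounded by the initial energy). [cite: Tao2011, Cor. 11.1 + Cor. 4.3 + Thm. 5.4 (iv)] -/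
theorem exists_forall_norm_le_of_tao2011 (h₁ : tao2011_hasBoundedSobolevNormsOn) {ν T : ℝ}
    (hν : 0 < ν) {u : ℝ → ℝ³ → ℝ³} {p : ℝ → ℝ³ → ℝ}
    (hsol : FluidPDE.IsClassicalNSSolutionOn (Ico 0 T) ν 0 u p)
    (hLH : FluidPDE.IsLerayHopfOn T ν 0 (u 0) u) (h₀ : HasRapidSpatialDecay (u 0)) :
    ∀ T₁ ∈ Ioo 0 T, ∃ M : ℝ, ∀ t ∈ Icc 0 T₁, ∀ x, ‖u t x‖ ≤ M := by
  intro T₁ hT₁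
  have hsol' : FluidPDE.IsClassicalNSSolutionOn (Icc 0 T₁) ν 0 u p :=
    hsol.mono (Icc_subset_Ico_right hT₁.2) (uniqueDiffOn_Icc hT₁.1)
  have hEn' : ∃ C : ℝ≥0∞, C < ⊤ ∧ ∀ t ∈ Icc 0 T₁, ∫⁻ x, ‖u t x‖ₑ ^ 2 ≤ C :=
    ⟨ENNReal.ofReal (2 * VectorCalculus.kineticEnergy (u 0)), ENNReal.ofReal_lt_top, fun t ht =>
      hLH.lintegral_enorm_sq_le hν.le ⟨ht.1, ht.2.trans hT₁.2.le⟩⟩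
  have hH : HasBoundedSobolevNormsOn (Icc 0 T₁) u :=
    (tao2011_hasBoundedSobolevNormsOn.closedSlab h₁ linfty_bound_of_hasBoundedSobolevNormsOn_holds
      ν T₁ hν hT₁.1 u p hsol' hEn' h₀).1
  exact linfty_bound_of_hasBoundedSobolevNormsOn_holds
    (fun t ht => (hsol'.contDiff_velocity ht).of_le (by norm_cast)) hH

-- `linter.deprecated` is switched off for the next declaration only: it names the deprecated
-- (mis-stated, 2026-08-15) tree-class rendering(s) of GKP Thm. 1 (`gkp_besov_blowup`,
-- `CriticalRegularity.lean`), kept unchanged for their users until the faithful path-space forms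
-- are vendored (see those files).
set_option linter.deprecated false in
/-- **The critical Besov continuation criterion from GKP's Theorem 1 and the KNSS smoothing of
bounded solutions** (Gallagher–Koch–Planchon 2016, Thm. 1, contrapositive; identification via
Tao 2013 and GKP (1.6) in the bounded form of KNSS 2009, §4). Given the named facts
`gkp_besov_blowup` (Thm. 1), `tao2011_hasBoundedSobolevNormsOn` (Tao Cor. 11.1 + Cor. 4.3 +
Thm. 5.4 (iv)), `tao2011_isMildNSSolutionOn_of_memSobolevX` (Cor. 4.3),
`tao2011_smooth_local_existence` (Thm. 5.4 (ii)+(iv)) and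
`knss_classical_of_bounded_isBesovMildSolutionOn` (KNSS §4) — the Littlewood–Paley facts of the
original assembly being supplied by their discharges `tendsto_lowFreqCutoff_of_memLp_two_holds`,
`eHomBesovNorm_le_of_sobolev_one_holds` — every classical unforced solution on `ℝ³ × [0, T)`
which is Leray–Hopf from its rapidly decaying datum and whose distributions have
`sup_{0 ≤ t < T} ‖U t‖_{Ḃ^{-1+3/r}_{r,q}} < ∞`, `3 < r, q < ∞`, extends as a classical solution
past `T`. Proof: `(u, U)` is a Besov mild solution on `[0, T)` (`isBesovMildSolutionOn_of_classical`),
not maximal by Thm. 1 (`gkp_besov_blowup.not_isMaximalBesovMildSolution_of_biSup_lt_top`), hence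
extended by some Besov mild `(v, V)` on `[0, T')`, `T' > T`; `u` is bounded on closed slabs
(`exists_forall_norm_le_of_tao2011`), so the extension is smooth
(`hasSmoothExtensionPast_of_isBesovMildSolutionOn_extension_of_bounded`). [cite: GKP2016, Thm. 1] -/
theorem hasSmoothExtensionPast_of_eHomBesovNorm_bounded_of_gkp_knss (hG : gkp_besov_blowup)
    (h₁ : tao2011_hasBoundedSobolevNormsOn) (h₂ : tao2011_isMildNSSolutionOn_of_memSobolevX)
    (hTao : tao2011_smooth_local_existence)
    (hK : knss_classical_of_bounded_isBesovMildSolutionOn) :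
    hasSmoothExtensionPast_of_eHomBesovNorm_bounded := by
  intro ν T hν hT u p U r q _ hr₃ hr hq₃ hq hsol hLH h₀ hU hsup
  have hr₂ : 2 ≤ r := le_trans (by norm_num) hr₃.le
  have hq₂ : 2 ≤ q := le_trans (by norm_num) hq₃.le
  have hq₁ : 1 ≤ q := le_trans (by norm_num) hq₃.le
  -- step 1: `(u, U)` is a Besov mild solution on `[0, T)`
  have hB : IsBesovMildSolutionOn (-1 + 3 / r.toReal) r q T ν u U :=
    isBesovMildSolutionOn_of_classical h₁ h₂ hTao tendsto_lowFreqCutoff_of_memLp_two_holds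
      eHomBesovNorm_le_of_sobolev_one_holds hν hT hsol hLH h₀ hU hr₂ hr hq₂
  -- step 2: by GKP's Theorem 1 it is not maximal
  have hnot : ¬ IsMaximalBesovMildSolution (-1 + 3 / r.toReal) r q T ν u U :=
    hG.not_isMaximalBesovMildSolution_of_biSup_lt_top hν hr₃ hr hq₃ hq hT hsup
  -- step 3: `u` is bounded on closed slabs, so a Besov mild extension is a smooth extension
  have hbdd := exists_forall_norm_le_of_tao2011 h₁ hν hsol hLH h₀
  by_contra hext
  refine hnot ⟨hB, ?_⟩
  rintro ⟨T', hT', v, V, hv, hvu⟩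
  exact hext (hasSmoothExtensionPast_of_isBesovMildSolutionOn_extension_of_bounded hK hν hT hT' hsol
    hbdd hr₃ hr hq₁ hq hv hvu)

-- `linter.deprecated` is switched off for the next declaration only: it names the deprecated
-- (mis-stated, 2026-08-15) tree-class rendering(s) of GKP Thm. 1 (`gkp_besov_blowup`,
-- `CriticalRegularity.lean`), kept unchanged for their users until the faithful path-space forms
-- are vendored (see those files).
set_option linter.deprecated false in
/-- **The route's dependency record.** `hasSmoothExtensionPast_of_eHomBesovNorm_bounded` holds as
soon as the five remaining named facts are discharged: GKP Thm. 1, the three Tao 2013 facts, and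
the KNSS smoothing fact; stated as the implication from their conjunction. [cite: GKP2016, Thm. 1] -/
theorem hasSmoothExtensionPast_of_eHomBesovNorm_bounded_of_and
    (h : gkp_besov_blowup ∧ tao2011_hasBoundedSobolevNormsOn ∧
      tao2011_isMildNSSolutionOn_of_memSobolevX ∧ tao2011_smooth_local_existence ∧
      knss_classical_of_bounded_isBesovMildSolutionOn) :
    hasSmoothExtensionPast_of_eHomBesovNorm_bounded :=
  hasSmoothExtensionPast_of_eHomBesovNorm_bounded_of_gkp_knss h.1 h.2.1 h.2.2.1 h.2.2.2.1 h.2.2.2.2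

end Assembly

end Literature.Analysis.FluidPDE

end
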